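import Literature.MathematicalPhysics.QuantumLattice.FermionQuasiFreeTimeOrderedWick
import Literature.MathematicalPhysics.QuantumLattice.DysonOrderedIntegral
import Literature.MathematicalPhysics.QuantumLattice.HubbardFermiLiquid
import HarnessLib

/-!
# The perturbation series of the Hubbard two-point function in determinant form (BGM (2.8))

Topic `MathematicalPhysics/QuantumLattice`; the assembly of `DysonExpansion.lean` (Dyson series
of `e^{-β(H₀+UV)}`), `DysonOrderedIntegral.lean` (its coefficients as ordered integrals of free
time-ordered expectations) and `FermionQuasiFreeTimeOrderedWick.lean` (the time-ordered thermal
Wick theorem in determinant form) into the statement with which Benfatto–Giuliani–Mastropietro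
(Ann. Henri Poincaré 7 (2006) 809, §2.1, pp. 5–6 of the held arXiv text) open their analysis of the
2D Hubbard model: the two-point Schwinger function and the partition function are given by "the
usual formal power series in `U`" whose order-`k` coefficient is the integral over `k` interaction
times of a sum over `k` interaction sites of the DETERMINANT of the free propagators
`g(𝐱 - 𝐲)` (1.3)–(1.4) between the `2k+1` (resp. `2k`) creation/annihilation pairs — in BGM
written as the Grassmann integrals (2.8) (resp. (2.6)), here at the operator level, in every
finite volume, where the series converges for every `U` (programme under the tree's fact
`bgm_two_point_limit`, `HubbardFermiLiquid.lean`; the thermodynamic limit and the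
renormalisation-group resummation of BGM §2.2–§3 are NOT touched here).

* `prod_ofFn_mul_two` — regrouping an ordered product over `Fin (2k)` into `k` pairs;
* `hubbardWordOrb`, `hubbardWordTime` — the orbital and time labels of the `2k+1` pairs of the
  word `c†_{xσ}c_{yσ'} ∏_i a⁺_{x_i↑}(s_i)a⁻_{x_i↑}(s_i)a⁺_{x_i↓}(s_i)a⁻_{x_i↓}(s_i)` (bookkeeping);
* `gibbsState_dGamma_twoPoint_mul_prod_hubbardVertex_eq_det`,
  `gibbsState_dGamma_prod_hubbardVertex_eq_det` — the free expectations of these words are the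
  `(2k+1)×(2k+1)` (resp. `2k×2k`) determinants of free propagators (time-ordered Wick theorem);
* **`hasSum_hubbard_twoPoint_det`** — `Tr(e^{-β(H(t,U)-μN)} c†_{xσ}c_{yσ'}) =
  Σ_k U^k (-β)^k ∫_{0≤u₀≤⋯≤u_{k-1}≤1} Σ_{x⃗∈Λ^k} Z₀ det G_k(x⃗,u) du` on any finite graph;
  **`hasSum_hubbard_partitionFn_det`** — the same for `Tr e^{-β(H(t,U)-μN)}`.

Everything is PROVED; the only definitions are the two label maps.

## References

* G. Benfatto, A. Giuliani, V. Mastropietro, Ann. Henri Poincaré 7 (2006) 809–898, §1.2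
  (1.2)–(1.4) and footnote 1 (time ordering, creation before annihilation at equal times), §2.1
  (2.6)–(2.8) (arXiv:cond-mat/0507686, pp. 2, 5–6). [BenfattoGiulianiMastropietro2006]
* M. Gaudin, Nucl. Phys. 15 (1960) 89–91 (the Wick rule). [Gaudin1960]
* O. Bratteli, D. W. Robinson, *Operator Algebras and Quantum Statistical Mechanics II*, 2nd ed.
  (Springer 1997), §5.2.4, §5.4.1. [BratteliRobinsonII1997]
-/

noncomputable section

namespace Literature.MathematicalPhysics.QuantumLattice

open NormedSpace Matrix Finset
open scoped ComplexOrder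

section PairIndex

/-- Regrouping an ordered product over `Fin (k·2)` into `k` consecutive pairs. [folklore] -/
theorem prod_ofFn_mul_two {M : Type*} [Monoid M] (k : ℕ) (g : Fin (k * 2) → M) :
    (List.ofFn g).prod =
      (List.ofFn fun i : Fin k => g (finProdFinEquiv (i, 0)) * g (finProdFinEquiv (i, 1))).prod := by
  rw [List.ofFn_mul, List.prod_flatten, List.map_ofFn]
  congr 1
  refine List.ofFn_inj.mpr (funext fun i => ?_)
  simp only [Function.comp_apply, List.ofFn_succ, List.ofFn_zero, List.prod_cons, List.prod_nil,
    mul_one]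
  congr 1 <;> congr 1 <;> apply Fin.ext <;> simp [finProdFinEquiv] <;> omega

end PairIndex

section HubbardWord

variable {Λ : Type*}

/-- The orbital map of the word `c†_{xσ}c_{yσ'} ∏_i (n_{x_i↑}n_{x_i↓})(s_i)` written as an
alternating product of `2k+1` creation/annihilation pairs: position `0` carries the observable
orbital, position `1 + 2i + j` the orbital `(x_i, j)`. [folklore] -/
def hubbardWordOrb {k : ℕ} (o : Orb Λ) (f : Fin k → Λ) : Fin (k * 2 + 1) → Orb Λ :=
  Fin.cons o fun m => orb (f (finProdFinEquiv.symm m).1) (finProdFinEquiv.symm m).2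

/-- The time map of the same word: `0` for the observable, `s_i` for the pairs of vertex `i`.
[folklore] -/
def hubbardWordTime {k : ℕ} (s : Fin k → ℂ) : Fin (k * 2 + 1) → ℂ :=
  Fin.cons 0 fun m => s (finProdFinEquiv.symm m).1

/-- Position `0` carries the observable orbital. [folklore] -/
@[simp] theorem hubbardWordOrb_zero {k : ℕ} (o : Orb Λ) (f : Fin k → Λ) :
    hubbardWordOrb o f 0 = o := rfl

/-- Position `1 + 2i + j` carries the orbital `(x_i, j)`. [folklore] -/
@[simp] theorem hubbardWordOrb_succ {k : ℕ} (o : Orb Λ) (f : Fin k → Λ) (m : Fin (k * 2)) :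
    hubbardWordOrb o f m.succ = orb (f (finProdFinEquiv.symm m).1) (finProdFinEquiv.symm m).2 := by
  simp [hubbardWordOrb]

/-- The observable sits at time `0`. [folklore] -/
@[simp] theorem hubbardWordTime_zero {k : ℕ} (s : Fin k → ℂ) : hubbardWordTime s 0 = 0 := rfl

/-- The pairs of vertex `i` sit at time `s_i`. [folklore] -/
@[simp] theorem hubbardWordTime_succ {k : ℕ} (s : Fin k → ℂ) (m : Fin (k * 2)) :
    hubbardWordTime s m.succ = s (finProdFinEquiv.symm m).1 := by
  simp [hubbardWordTime]

end HubbardWord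

section HubbardWick

variable {Λ : Type*} [LinearOrder Λ] [Fintype Λ]

/-- **The free expectations in the Dyson coefficients of the Hubbard two-point function are
determinants** (the time-ordered Wick theorem applied to the word
`c†_{xσ} c_{yσ'} ∏_i a⁺_{x_i↑}(s_i)a⁻_{x_i↑}(s_i)a⁺_{x_i↓}(s_i)a⁻_{x_i↓}(s_i)`): for a Hermitian
one-body matrix `h` on the orbitals and `a^±(s) = e^{s dΓ(h)} c^± e^{-s dΓ(h)}`,
`⟨c†_{xσ}c_{yσ'} ∏_i (⋯)⟩_{β, dΓ(h)} = det G` with the `(2k+1) × (2k+1)` matrix of free propagators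
`G_{ab} = [e^{-t_b h}(1+e^{βh})⁻¹e^{t_a h}]_{o_b o_a}` (`a ≤ b`), `-[e^{-t_b h}(1+e^{-βh})⁻¹e^{t_a h}]_{o_b o_a}`
(`a > b`), orbitals `o = hubbardWordOrb` (creation side with `(x,σ)`, annihilation side with
`(y,σ')`) and times `t = hubbardWordTime s`. BGM 2006 §2.1 (2.8) with the Wick rule of §1.2.
[cite: BenfattoGiulianiMastropietro2006, §2.1 (2.8)] -/
theorem gibbsState_dGamma_twoPoint_mul_prod_hubbardVertex_eq_det {h : Matrix (Orb Λ) (Orb Λ) ℂ}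
    (hh : h.IsHermitian) (β : ℝ) {k : ℕ} (x y : Λ) (σ σ' : Fin 2) (f : Fin k → Λ) (s : Fin k → ℂ) :
    gibbsState β (dGamma h) (creation (orb x σ) * annihilation (orb y σ') *
        (List.ofFn fun i : Fin k =>
          (exp (s i • dGamma h) * creation (orb (f i) 0) * exp (-(s i • dGamma h))) *
              (exp (s i • dGamma h) * annihilation (orb (f i) 0) * exp (-(s i • dGamma h))) *
            ((exp (s i • dGamma h) * creation (orb (f i) 1) * exp (-(s i • dGamma h))) *
              (exp (s i • dGamma h) * annihilation (orb (f i) 1) * exp (-(s i • dGamma h))))).prod) =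
      (Matrix.of fun a b : Fin (k * 2 + 1) =>
          if a ≤ b then
            (exp (-(hubbardWordTime s b • h)) * (1 + exp ((β : ℂ) • h))⁻¹ *
              exp (hubbardWordTime s a • h)) (hubbardWordOrb (orb y σ') f b) (hubbardWordOrb (orb x σ) f a)
          else
            -(exp (-(hubbardWordTime s b • h)) * (1 + exp (-((β : ℂ) • h)))⁻¹ *
              exp (hubbardWordTime s a • h)) (hubbardWordOrb (orb y σ') f b)
                (hubbardWordOrb (orb x σ) f a)).det := by
  have key := gibbsState_dGamma_prod_evolved_eq_det hh β (hubbardWordOrb (orb x σ) f)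
    (hubbardWordOrb (orb y σ') f) (hubbardWordTime s) (hubbardWordTime s)
  rw [List.ofFn_succ, List.prod_cons] at key
  simp only [hubbardWordOrb_zero, hubbardWordTime_zero, hubbardWordOrb_succ, hubbardWordTime_succ,
    zero_smul, neg_zero, exp_zero, Matrix.one_mul, Matrix.mul_one] at key
  rw [prod_ofFn_mul_two] at key
  simp only [Equiv.symm_apply_apply] at key
  exact key

/-- The same for the partition-function coefficients (no observable): the word
`∏_i a⁺_{x_i↑}(s_i)a⁻_{x_i↑}(s_i)a⁺_{x_i↓}(s_i)a⁻_{x_i↓}(s_i)` has free expectation `det G` with the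
`2k × 2k` matrix of free propagators on the orbitals `(x_i, j)` at times `s_i`.
BGM 2006 §2.1 (2.6). [cite: BenfattoGiulianiMastropietro2006, §2.1 (2.6)] -/
theorem gibbsState_dGamma_prod_hubbardVertex_eq_det {h : Matrix (Orb Λ) (Orb Λ) ℂ}
    (hh : h.IsHermitian) (β : ℝ) {k : ℕ} (f : Fin k → Λ) (s : Fin k → ℂ) :
    gibbsState β (dGamma h)
        (List.ofFn fun i : Fin k =>
          (exp (s i • dGamma h) * creation (orb (f i) 0) * exp (-(s i • dGamma h))) *
              (exp (s i • dGamma h) * annihilation (orb (f i) 0) * exp (-(s i • dGamma h))) *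
            ((exp (s i • dGamma h) * creation (orb (f i) 1) * exp (-(s i • dGamma h))) *
              (exp (s i • dGamma h) * annihilation (orb (f i) 1) * exp (-(s i • dGamma h))))).prod =
      (Matrix.of fun a b : Fin (k * 2) =>
          if a ≤ b then
            (exp (-(s (finProdFinEquiv.symm b).1 • h)) * (1 + exp ((β : ℂ) • h))⁻¹ *
              exp (s (finProdFinEquiv.symm a).1 • h))
              (orb (f (finProdFinEquiv.symm b).1) (finProdFinEquiv.symm b).2)
              (orb (f (finProdFinEquiv.symm a).1) (finProdFinEquiv.symm a).2)
          else
            -(exp (-(s (finProdFinEquiv.symm b).1 • h)) * (1 + exp (-((β : ℂ) • h)))⁻¹ *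
              exp (s (finProdFinEquiv.symm a).1 • h))
              (orb (f (finProdFinEquiv.symm b).1) (finProdFinEquiv.symm b).2)
              (orb (f (finProdFinEquiv.symm a).1) (finProdFinEquiv.symm a).2)).det := by
  have key := gibbsState_dGamma_prod_evolved_eq_det hh β
    (fun m : Fin (k * 2) => orb (f (finProdFinEquiv.symm m).1) (finProdFinEquiv.symm m).2)
    (fun m : Fin (k * 2) => orb (f (finProdFinEquiv.symm m).1) (finProdFinEquiv.symm m).2)
    (fun m => s (finProdFinEquiv.symm m).1) (fun m => s (finProdFinEquiv.symm m).1)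
  rw [prod_ofFn_mul_two] at key
  simp only [Equiv.symm_apply_apply] at key
  exact key

end HubbardWick


/-! ### Assembly: the perturbation series of the Hubbard model in determinant form -/

section Assembly

variable {Λ : Type*} [LinearOrder Λ] [Fintype Λ] (G : SimpleGraph Λ) [DecidableRel G.Adj]

/-- **BGM's perturbation series (2.8) for the Hubbard two-point function, in determinant form
(finite volume, operator level).** On any finite graph, for all real `β, t, μ, U`, sites `x, y`
and spins `σ, σ'`, with `h = hubbardOneBody G t μ` (`H₀ = dΓ(h)`), `Z₀ = Tr e^{-βH₀}`:
`Tr(e^{-β(H(t,U)-μN)} c†_{xσ} c_{yσ'}) = Σ_k U^k (-β)^k ∫_{0≤u₀≤⋯≤u_{k-1}≤1} Σ_{x⃗ ∈ Λ^k} Z₀ det G_k(x⃗, u) du`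
where `G_k` is the `(2k+1) × (2k+1)` matrix of free propagators between the `2k+1`
creation/annihilation pairs of the word `c†_{xσ}c_{yσ'} ∏_i n_{x_i↑}(s_i) n_{x_i↓}(s_i)`
(`s_i = -βu_i`, orbitals `hubbardWordOrb`, times `hubbardWordTime`): entry
`[e^{-s_b h}(1+e^{βh})⁻¹e^{s_a h}]_{o_b o_a}` above the diagonal (creation pair `a` before
annihilation pair `b`) and `-[e^{-s_b h}(1+e^{-βh})⁻¹e^{s_a h}]_{o_b o_a}` below it — i.e.
`-g(𝐱_b - 𝐲_a)` with BGM's time-ordered free propagator (1.3)–(1.4) (creation before annihilation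
at equal times, footnote 1). This is the "usual formal power series in `U` … for the Schwinger
functions" of BGM §2.1 (there encoded as the Grassmann integral (2.8)), proved convergent for
every `U` in every finite volume: `DysonExpansion` + `DysonOrderedIntegral` + the time-ordered
Wick theorem of `FermionQuasiFreeTimeOrderedWick`. BGM 2006 §1.2 (1.2)–(1.4), §2.1 (2.6)–(2.8).
[cite: BenfattoGiulianiMastropietro2006, §2.1 (2.8)] -/
theorem hasSum_hubbard_twoPoint_det (β t U μ : ℝ) (x y : Λ) (σ σ' : Fin 2) :
    HasSum (fun k : ℕ => (U : ℂ) ^ k * orderedIntegral k (fun u : Fin k → ℝ =>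
        (-(β : ℂ)) ^ k * ∑ f : Fin k → Λ, Matrix.partitionFn β (dGamma (hubbardOneBody G t μ)) *
          (Matrix.of fun a b : Fin (k * 2 + 1) =>
            if a ≤ b then
              (exp (-(hubbardWordTime (fun i : Fin k => ((u i : ℝ) : ℂ) * -(β : ℂ)) b • hubbardOneBody G t μ)) * (1 + exp ((β : ℂ) • hubbardOneBody G t μ))⁻¹ *
                exp (hubbardWordTime (fun i : Fin k => ((u i : ℝ) : ℂ) * -(β : ℂ)) a • hubbardOneBody G t μ)) (hubbardWordOrb (orb y σ') f b) (hubbardWordOrb (orb x σ) f a)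
            else
              -(exp (-(hubbardWordTime (fun i : Fin k => ((u i : ℝ) : ℂ) * -(β : ℂ)) b • hubbardOneBody G t μ)) * (1 + exp (-((β : ℂ) • hubbardOneBody G t μ)))⁻¹ *
                exp (hubbardWordTime (fun i : Fin k => ((u i : ℝ) : ℂ) * -(β : ℂ)) a • hubbardOneBody G t μ)) (hubbardWordOrb (orb y σ') f b) (hubbardWordOrb (orb x σ) f a)).det) 1)
      ((Matrix.gibbsWeight β (hamiltonianWith G t U μ) *
        (creation (orb x σ) * annihilation (orb y σ'))).trace) := by
  haveI : Nonempty (Finset (Orb Λ)) := ⟨∅⟩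
  have hZ : Matrix.partitionFn β (dGamma (hubbardOneBody G t μ)) ≠ 0 :=
    (Matrix.partitionFn_pos β (isHermitian_dGamma (isHermitian_hubbardOneBody G t μ))).ne'
  refine (hasSum_hubbard_trace_gibbsWeight_twoPoint G β t U μ x y σ σ').congr_fun fun k => ?_
  refine congrArg (fun F => (U : ℂ) ^ k * orderedIntegral k F 1) (funext fun u => ?_)
  refine congrArg (fun S => (-(β : ℂ)) ^ k * S) (Finset.sum_congr rfl fun f _ => ?_)
  rw [← gibbsState_dGamma_twoPoint_mul_prod_hubbardVertex_eq_det (isHermitian_hubbardOneBody G t μ) β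
    x y σ σ' f (fun i : Fin k => ((u i : ℝ) : ℂ) * -(β : ℂ)), Matrix.gibbsState_apply,
    mul_inv_cancel_left₀ hZ]

/-- **BGM's (2.6) for the Hubbard partition function, in determinant form (finite volume):**
`Tr e^{-β(H(t,U)-μN)} = Σ_k U^k (-β)^k ∫_{0≤u₀≤⋯≤u_{k-1}≤1} Σ_{x⃗ ∈ Λ^k} Z₀ det G'_k(x⃗, u) du` with the
`2k × 2k` matrix of free propagators between the pairs of `∏_i n_{x_i↑}(s_i) n_{x_i↓}(s_i)`
(position `2i + j` ↔ orbital `(x_i, j)` at time `s_i = -βu_i`). BGM 2006 §2.1 (2.6).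
[cite: BenfattoGiulianiMastropietro2006, §2.1 (2.6)] -/
theorem hasSum_hubbard_partitionFn_det (β t U μ : ℝ) :
    HasSum (fun k : ℕ => (U : ℂ) ^ k * orderedIntegral k (fun u : Fin k → ℝ =>
        (-(β : ℂ)) ^ k * ∑ f : Fin k → Λ, Matrix.partitionFn β (dGamma (hubbardOneBody G t μ)) *
          (Matrix.of fun a b : Fin (k * 2) =>
            if a ≤ b then
              (exp (-((((u (finProdFinEquiv.symm b).1 : ℝ) : ℂ) * -(β : ℂ)) • hubbardOneBody G t μ)) * (1 + exp ((β : ℂ) • hubbardOneBody G t μ))⁻¹ *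
                exp ((((u (finProdFinEquiv.symm a).1 : ℝ) : ℂ) * -(β : ℂ)) • hubbardOneBody G t μ)) (orb (f (finProdFinEquiv.symm b).1) (finProdFinEquiv.symm b).2) (orb (f (finProdFinEquiv.symm a).1) (finProdFinEquiv.symm a).2)
            else
              -(exp (-((((u (finProdFinEquiv.symm b).1 : ℝ) : ℂ) * -(β : ℂ)) • hubbardOneBody G t μ)) * (1 + exp (-((β : ℂ) • hubbardOneBody G t μ)))⁻¹ *
                exp ((((u (finProdFinEquiv.symm a).1 : ℝ) : ℂ) * -(β : ℂ)) • hubbardOneBody G t μ)) (orb (f (finProdFinEquiv.symm b).1) (finProdFinEquiv.symm b).2) (orb (f (finProdFinEquiv.symm a).1) (finProdFinEquiv.symm a).2)).det) 1)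
      (Matrix.partitionFn β (hamiltonianWith G t U μ)) := by
  haveI : Nonempty (Finset (Orb Λ)) := ⟨∅⟩
  have hZ : Matrix.partitionFn β (dGamma (hubbardOneBody G t μ)) ≠ 0 :=
    (Matrix.partitionFn_pos β (isHermitian_dGamma (isHermitian_hubbardOneBody G t μ))).ne'
  refine (hasSum_hubbard_partitionFn G β t U μ).congr_fun fun k => ?_
  refine congrArg (fun F => (U : ℂ) ^ k * orderedIntegral k F 1) (funext fun u => ?_)
  refine congrArg (fun S => (-(β : ℂ)) ^ k * S) (Finset.sum_congr rfl fun f _ => ?_)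
  rw [← gibbsState_dGamma_prod_hubbardVertex_eq_det (isHermitian_hubbardOneBody G t μ) β f
    (fun i : Fin k => ((u i : ℝ) : ℂ) * -(β : ℂ)), Matrix.gibbsState_apply, mul_inv_cancel_left₀ hZ]

end Assembly


/-! ### The two-point function of the tree's fact `bgm_two_point_limit` -/

section TorusTwoPoint

open Literature.Probability.LatticeModels

/-- **The Hubbard two-point function on the torus as a ratio of two entire series in `U` with
determinant coefficients** — the object of the tree's fact `bgm_two_point_limit`
(`hubbardThermalTwoPoint β U μ L x y σ σ'`, `L ≠ 0` via `[NeZero L]`) in the form of BGM's (2.8):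
numerator and denominator are the series of `hasSum_hubbard_twoPoint_det` and
`hasSum_hubbard_partitionFn_det` on the torus `(ℤ/Lℤ)²` with hopping `t = 1`.
BGM 2006 §2.1 (2.8). [cite: BenfattoGiulianiMastropietro2006, §2.1 (2.8)] -/
theorem hubbardThermalTwoPoint_eq_tsum_div_tsum (β U μ : ℝ) {L : ℕ} [NeZero L] (x y : Site 2)
    (σ σ' : Fin 2) :
    hubbardThermalTwoPoint β U μ L x y σ σ' =
      (∑' k : ℕ, (U : ℂ) ^ k * orderedIntegral k (fun u : Fin k → ℝ =>
        (-(β : ℂ)) ^ k * ∑ f : Fin k → FermionTorus 2 L, Matrix.partitionFn β (dGamma (hubbardOneBody (fermionTorusGraph 2 L) 1 μ)) *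
          (Matrix.of fun a b : Fin (k * 2 + 1) =>
            if a ≤ b then
              (exp (-(hubbardWordTime (fun i : Fin k => ((u i : ℝ) : ℂ) * -(β : ℂ)) b • hubbardOneBody (fermionTorusGraph 2 L) 1 μ)) * (1 + exp ((β : ℂ) • hubbardOneBody (fermionTorusGraph 2 L) 1 μ))⁻¹ *
                exp (hubbardWordTime (fun i : Fin k => ((u i : ℝ) : ℂ) * -(β : ℂ)) a • hubbardOneBody (fermionTorusGraph 2 L) 1 μ)) (hubbardWordOrb (orb (FermionTorus.ofTorusSite (Torus.proj L y)) σ') f b) (hubbardWordOrb (orb (FermionTorus.ofTorusSite (Torus.proj L x)) σ) f a)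
            else
              -(exp (-(hubbardWordTime (fun i : Fin k => ((u i : ℝ) : ℂ) * -(β : ℂ)) b • hubbardOneBody (fermionTorusGraph 2 L) 1 μ)) * (1 + exp (-((β : ℂ) • hubbardOneBody (fermionTorusGraph 2 L) 1 μ)))⁻¹ *
                exp (hubbardWordTime (fun i : Fin k => ((u i : ℝ) : ℂ) * -(β : ℂ)) a • hubbardOneBody (fermionTorusGraph 2 L) 1 μ)) (hubbardWordOrb (orb (FermionTorus.ofTorusSite (Torus.proj L y)) σ') f b) (hubbardWordOrb (orb (FermionTorus.ofTorusSite (Torus.proj L x)) σ) f a)).det) 1) /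
      (∑' k : ℕ, (U : ℂ) ^ k * orderedIntegral k (fun u : Fin k → ℝ =>
        (-(β : ℂ)) ^ k * ∑ f : Fin k → FermionTorus 2 L, Matrix.partitionFn β (dGamma (hubbardOneBody (fermionTorusGraph 2 L) 1 μ)) *
          (Matrix.of fun a b : Fin (k * 2) =>
            if a ≤ b then
              (exp (-((((u (finProdFinEquiv.symm b).1 : ℝ) : ℂ) * -(β : ℂ)) • hubbardOneBody (fermionTorusGraph 2 L) 1 μ)) * (1 + exp ((β : ℂ) • hubbardOneBody (fermionTorusGraph 2 L) 1 μ))⁻¹ *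
                exp ((((u (finProdFinEquiv.symm a).1 : ℝ) : ℂ) * -(β : ℂ)) • hubbardOneBody (fermionTorusGraph 2 L) 1 μ)) (orb (f (finProdFinEquiv.symm b).1) (finProdFinEquiv.symm b).2) (orb (f (finProdFinEquiv.symm a).1) (finProdFinEquiv.symm a).2)
            else
              -(exp (-((((u (finProdFinEquiv.symm b).1 : ℝ) : ℂ) * -(β : ℂ)) • hubbardOneBody (fermionTorusGraph 2 L) 1 μ)) * (1 + exp (-((β : ℂ) • hubbardOneBody (fermionTorusGraph 2 L) 1 μ)))⁻¹ *
                exp ((((u (finProdFinEquiv.symm a).1 : ℝ) : ℂ) * -(β : ℂ)) • hubbardOneBody (fermionTorusGraph 2 L) 1 μ)) (orb (f (finProdFinEquiv.symm b).1) (finProdFinEquiv.symm b).2) (orb (f (finProdFinEquiv.symm a).1) (finProdFinEquiv.symm a).2)).det) 1) := by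
  have h1 := (hasSum_hubbard_twoPoint_det (fermionTorusGraph 2 L) β 1 U μ (FermionTorus.ofTorusSite (Torus.proj L x)) (FermionTorus.ofTorusSite (Torus.proj L y)) σ σ').tsum_eq
  have h2 := (hasSum_hubbard_partitionFn_det (fermionTorusGraph 2 L) β 1 U μ).tsum_eq
  have h0 : hubbardThermalTwoPoint β U μ L x y σ σ' =
      (Matrix.gibbsWeight β (hamiltonianWith (fermionTorusGraph 2 L) 1 U μ) *
          (creation (orb (FermionTorus.ofTorusSite (Torus.proj L x)) σ) * annihilation (orb (FermionTorus.ofTorusSite (Torus.proj L y)) σ'))).trace /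
        Matrix.partitionFn β (hamiltonianWith (fermionTorusGraph 2 L) 1 U μ) := by
    simp only [hubbardThermalTwoPoint, NeZero.ne L, dif_neg, not_false_eq_true, Matrix.thermalCorr,
      Matrix.gibbsState_apply, div_eq_inv_mul]
    rfl
  exact h0.trans (by convert congrArg₂ (fun a b : ℂ => a / b) h1.symm h2.symm)

end TorusTwoPoint

end Literature.MathematicalPhysics.QuantumLattice
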